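import Summits.Ventures.PercRepro.S2DirectCell
import Summits.Ventures.PercRepro.S2FlatSharp
import Summits.Ventures.PercRepro.S2TailFlats
import Summits.Ventures.PercRepro.S2ThirteenSixSpreadNine
import Summits.Ventures.PercRepro.RankLevelSetPlaneTenPrime
import Summits.Ventures.PercRepro.S2ElevenEightK2NuSix
import Summits.Ventures.PercRepro.S2LPPhi

/-!
# PercRepro — S2: THE KEY CELLS `(12, d)`, `39 ≤ d ≤ 50` — THE ROW `p = 12` WITHOUT SUB-CELLS (p7, gen 20; sub-claim S2)

For each corank `d` here, `RLS M 12 5` on every `e`-free core of rank `12` on `12 + d` points (coloops allowed, no coloop split): the flat-sharp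
lever `topCount_le_flat_sharp` at the universal core bounds `(19, 10)` on the plain caps `cq3 d / avgChain16 d / avgChain5b d`, the tail by flats
at `(19, 10)`, and the KEY inequality `Φ(12, 5)·U + A ≤ Σ_{s=6}^{11} C(n, s)` (`c025_core_five_cell_key`, S2DirectCell; `Φ(12, 5) = 127 / 7`,
`S2LP.phiK_twelve_five`) — one numeral per cell (ratios `0.977`, `0.887`, `0.807`, `0.735`, `0.671`, `0.613`, `0.561`, `0.515`, `0.473`, `0.434`, `0.400`, `0.369`). The mirror of the row `p = 13` key cells
(S2ThirteenKeyCellsA/B, gen 19) at `p = 12`. Nothing about the window is claimed. Axioms: standard.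
-/

open scoped Matroid

namespace PercRepro

namespace ThmN

open Set

variable {α : Type}

set_option maxRecDepth 8192 in
/-- **The key cell `(12, 39)`**: `RLS M 12 5` on every `e`-free core of rank `12` on `51` points (caps `780 / 18481 / 548738`; `#U ≤ 281909859442874317808359 / 86011480655100`,
`#{r ≤ 5} ≤ 282591801757104934597709 / 86011480655100`, `Σ_{s=6}^{11} C(51, s) = 64216588800`; ratio `0.977`). -/
theorem c025_twelve_key_39 (M : Matroid α) [M.Finite]
    (hR : M.eRank = ((12 : ℕ) : ℕ∞)) (hn : M.E.ncard = 12 + 39)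
    (hfree : ∀ e ∈ M.E, ∃ A ⊆ M.E \ {e}, e ∉ M.closure A ∧ e ∉ M.closure ((M.E \ {e}) \ A)) : RLS M 12 5 := by
  classical
  have hd : M.E.encard = M.eRank + ((39 : ℕ) : ℕ∞) := by
    rw [hR, ← M.ground_finite.cast_ncard_eq, hn]
    push_cast
    ring
  have hs3 := TriangleCap.core_ncard_triangles_le_cq3 M hfree hd
  rw [show TriangleCap.cq3 39 = 780 by decide] at hs3
  have hs4 := ncard_fourCircuits_le_avgChain16 39 M hfree hd
  rw [show avgChain16 39 = 18481 by decide] at hs4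
  have hs5 := S1.ncard_fiveCircuits_le_avgChain5b 39 M hfree hd
  rw [show S1.avgChain5b 39 = 548738 by decide] at hs5
  have hflat : ∀ X ⊆ M.E, M.eRk X ≤ 5 → X.ncard ≤ 19 := fun X hX hr => ncard_le_nineteen_of_eRk_le_five_of_free M hfree hX hr
  have hflat' : ∀ X ⊆ M.E, M.eRk X ≤ 4 → X.ncard ≤ 10 := fun X hX hr => ncard_le_ten_of_eRk_le_four_of_free M hfree hX hr
  have hU := topCount_le_flat_sharp M 12 39 (by norm_num) (by norm_num) hR hn hfree 19 10 hflat hflat' (by norm_num) (by norm_num)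
    780 18481 548738 hs3 hs4 hs5
  have hA := ncard_eRk_le_five_le_flats M 12 39 (by norm_num) hR hn hfree 19 10 hflat hflat' (by norm_num) (by norm_num)
    (by norm_num) (by norm_num) 780 18481 548738 hs3 hs4 hs5
  rw [RLS_iff]
  refine c025_core_five_cell_key M 12 39 hn _ hU _ hA (phiK 12 5) (by rw [S2LP.phiK_twelve_five]; norm_num) ?_
  rw [S2LP.phiK_twelve_five]
  norm_num [Finset.sum_range_succ, Finset.sum_Icc_succ_top, Nat.choose]

set_option maxRecDepth 8192 in
/-- **The key cell `(12, 40)`**: `RLS M 12 5` on every `e`-free core of rank `12` on `52` points (caps `820 / 20284 / 617330`; `#U ≤ 161050537465530358109899 / 43005740327550`,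
`#{r ≤ 5} ≤ 161428606114794792628289 / 43005740327550`, `Σ_{s=6}^{11} C(52, s) = 80809509690`; ratio `0.887`). -/
theorem c025_twelve_key_40 (M : Matroid α) [M.Finite]
    (hR : M.eRank = ((12 : ℕ) : ℕ∞)) (hn : M.E.ncard = 12 + 40)
    (hfree : ∀ e ∈ M.E, ∃ A ⊆ M.E \ {e}, e ∉ M.closure A ∧ e ∉ M.closure ((M.E \ {e}) \ A)) : RLS M 12 5 := by
  classical
  have hd : M.E.encard = M.eRank + ((40 : ℕ) : ℕ∞) := by
    rw [hR, ← M.ground_finite.cast_ncard_eq, hn]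
    push_cast
    ring
  have hs3 := TriangleCap.core_ncard_triangles_le_cq3 M hfree hd
  rw [show TriangleCap.cq3 40 = 820 by decide] at hs3
  have hs4 := ncard_fourCircuits_le_avgChain16 40 M hfree hd
  rw [show avgChain16 40 = 20284 by decide] at hs4
  have hs5 := S1.ncard_fiveCircuits_le_avgChain5b 40 M hfree hd
  rw [show S1.avgChain5b 40 = 617330 by decide] at hs5
  have hflat : ∀ X ⊆ M.E, M.eRk X ≤ 5 → X.ncard ≤ 19 := fun X hX hr => ncard_le_nineteen_of_eRk_le_five_of_free M hfree hX hr
  have hflat' : ∀ X ⊆ M.E, M.eRk X ≤ 4 → X.ncard ≤ 10 := fun X hX hr => ncard_le_ten_of_eRk_le_four_of_free M hfree hX hr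
  have hU := topCount_le_flat_sharp M 12 40 (by norm_num) (by norm_num) hR hn hfree 19 10 hflat hflat' (by norm_num) (by norm_num)
    820 20284 617330 hs3 hs4 hs5
  have hA := ncard_eRk_le_five_le_flats M 12 40 (by norm_num) hR hn hfree 19 10 hflat hflat' (by norm_num) (by norm_num)
    (by norm_num) (by norm_num) 820 20284 617330 hs3 hs4 hs5
  rw [RLS_iff]
  refine c025_core_five_cell_key M 12 40 hn _ hU _ hA (phiK 12 5) (by rw [S2LP.phiK_twelve_five]; norm_num) ?_
  rw [S2LP.phiK_twelve_five]
  norm_num [Finset.sum_range_succ, Finset.sum_Icc_succ_top, Nat.choose]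

set_option maxRecDepth 8192 in
/-- **The key cell `(12, 41)`**: `RLS M 12 5` on every `e`-free core of rank `12` on `53` points (caps `861 / 22215 / 692614`; `#U ≤ 3945721048429157484833 / 924854630700`,
`#{r ≤ 5} ≤ 11864150724223036160959 / 2774563892100`, `Σ_{s=6}^{11} C(53, s) = 101217889500`; ratio `0.807`). -/
theorem c025_twelve_key_41 (M : Matroid α) [M.Finite]
    (hR : M.eRank = ((12 : ℕ) : ℕ∞)) (hn : M.E.ncard = 12 + 41)
    (hfree : ∀ e ∈ M.E, ∃ A ⊆ M.E \ {e}, e ∉ M.closure A ∧ e ∉ M.closure ((M.E \ {e}) \ A)) : RLS M 12 5 := by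
  classical
  have hd : M.E.encard = M.eRank + ((41 : ℕ) : ℕ∞) := by
    rw [hR, ← M.ground_finite.cast_ncard_eq, hn]
    push_cast
    ring
  have hs3 := TriangleCap.core_ncard_triangles_le_cq3 M hfree hd
  rw [show TriangleCap.cq3 41 = 861 by decide] at hs3
  have hs4 := ncard_fourCircuits_le_avgChain16 41 M hfree hd
  rw [show avgChain16 41 = 22215 by decide] at hs4
  have hs5 := S1.ncard_fiveCircuits_le_avgChain5b 41 M hfree hd
  rw [show S1.avgChain5b 41 = 692614 by decide] at hs5
  have hflat : ∀ X ⊆ M.E, M.eRk X ≤ 5 → X.ncard ≤ 19 := fun X hX hr => ncard_le_nineteen_of_eRk_le_five_of_free M hfree hX hr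
  have hflat' : ∀ X ⊆ M.E, M.eRk X ≤ 4 → X.ncard ≤ 10 := fun X hX hr => ncard_le_ten_of_eRk_le_four_of_free M hfree hX hr
  have hU := topCount_le_flat_sharp M 12 41 (by norm_num) (by norm_num) hR hn hfree 19 10 hflat hflat' (by norm_num) (by norm_num)
    861 22215 692614 hs3 hs4 hs5
  have hA := ncard_eRk_le_five_le_flats M 12 41 (by norm_num) hR hn hfree 19 10 hflat hflat' (by norm_num) (by norm_num)
    (by norm_num) (by norm_num) 861 22215 692614 hs3 hs4 hs5
  rw [RLS_iff]
  refine c025_core_five_cell_key M 12 41 hn _ hU _ hA (phiK 12 5) (by rw [S2LP.phiK_twelve_five]; norm_num) ?_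
  rw [S2LP.phiK_twelve_five]
  norm_num [Finset.sum_range_succ, Finset.sum_Icc_succ_top, Nat.choose]

set_option maxRecDepth 8192 in
/-- **The key cell `(12, 42)`**: `RLS M 12 5` on every `e`-free core of rank `12` on `54` points (caps `903 / 24281 / 775068`; `#U ≤ 11911165036513501059277 / 2457470875860`,
`#{r ≤ 5} ≤ 3979186228413237362513 / 819156958620`, `Σ_{s=6}^{11} C(54, s) = 126214895625`; ratio `0.735`). -/
theorem c025_twelve_key_42 (M : Matroid α) [M.Finite]
    (hR : M.eRank = ((12 : ℕ) : ℕ∞)) (hn : M.E.ncard = 12 + 42)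
    (hfree : ∀ e ∈ M.E, ∃ A ⊆ M.E \ {e}, e ∉ M.closure A ∧ e ∉ M.closure ((M.E \ {e}) \ A)) : RLS M 12 5 := by
  classical
  have hd : M.E.encard = M.eRank + ((42 : ℕ) : ℕ∞) := by
    rw [hR, ← M.ground_finite.cast_ncard_eq, hn]
    push_cast
    ring
  have hs3 := TriangleCap.core_ncard_triangles_le_cq3 M hfree hd
  rw [show TriangleCap.cq3 42 = 903 by decide] at hs3
  have hs4 := ncard_fourCircuits_le_avgChain16 42 M hfree hd
  rw [show avgChain16 42 = 24281 by decide] at hs4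
  have hs5 := S1.ncard_fiveCircuits_le_avgChain5b 42 M hfree hd
  rw [show S1.avgChain5b 42 = 775068 by decide] at hs5
  have hflat : ∀ X ⊆ M.E, M.eRk X ≤ 5 → X.ncard ≤ 19 := fun X hX hr => ncard_le_nineteen_of_eRk_le_five_of_free M hfree hX hr
  have hflat' : ∀ X ⊆ M.E, M.eRk X ≤ 4 → X.ncard ≤ 10 := fun X hX hr => ncard_le_ten_of_eRk_le_four_of_free M hfree hX hr
  have hU := topCount_le_flat_sharp M 12 42 (by norm_num) (by norm_num) hR hn hfree 19 10 hflat hflat' (by norm_num) (by norm_num)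
    903 24281 775068 hs3 hs4 hs5
  have hA := ncard_eRk_le_five_le_flats M 12 42 (by norm_num) hR hn hfree 19 10 hflat hflat' (by norm_num) (by norm_num)
    (by norm_num) (by norm_num) 903 24281 775068 hs3 hs4 hs5
  rw [RLS_iff]
  refine c025_core_five_cell_key M 12 42 hn _ hU _ hA (phiK 12 5) (by rw [S2LP.phiK_twelve_five]; norm_num) ?_
  rw [S2LP.phiK_twelve_five]
  norm_num [Finset.sum_range_succ, Finset.sum_Icc_succ_top, Nat.choose]

set_option maxRecDepth 8192 in
/-- **The key cell `(12, 43)`**: `RLS M 12 5` on every `e`-free core of rank `12` on `55` points (caps `946 / 26488 / 865192`; `#U ≤ 118091989192657968295372 / 21502870163775`,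
`#{r ≤ 5} ≤ 118346496608054506909682 / 21502870163775`, `Σ_{s=6}^{11} C(55, s) = 156710101080`; ratio `0.671`). -/
theorem c025_twelve_key_43 (M : Matroid α) [M.Finite]
    (hR : M.eRank = ((12 : ℕ) : ℕ∞)) (hn : M.E.ncard = 12 + 43)
    (hfree : ∀ e ∈ M.E, ∃ A ⊆ M.E \ {e}, e ∉ M.closure A ∧ e ∉ M.closure ((M.E \ {e}) \ A)) : RLS M 12 5 := by
  classical
  have hd : M.E.encard = M.eRank + ((43 : ℕ) : ℕ∞) := by
    rw [hR, ← M.ground_finite.cast_ncard_eq, hn]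
    push_cast
    ring
  have hs3 := TriangleCap.core_ncard_triangles_le_cq3 M hfree hd
  rw [show TriangleCap.cq3 43 = 946 by decide] at hs3
  have hs4 := ncard_fourCircuits_le_avgChain16 43 M hfree hd
  rw [show avgChain16 43 = 26488 by decide] at hs4
  have hs5 := S1.ncard_fiveCircuits_le_avgChain5b 43 M hfree hd
  rw [show S1.avgChain5b 43 = 865192 by decide] at hs5
  have hflat : ∀ X ⊆ M.E, M.eRk X ≤ 5 → X.ncard ≤ 19 := fun X hX hr => ncard_le_nineteen_of_eRk_le_five_of_free M hfree hX hr
  have hflat' : ∀ X ⊆ M.E, M.eRk X ≤ 4 → X.ncard ≤ 10 := fun X hX hr => ncard_le_ten_of_eRk_le_four_of_free M hfree hX hr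
  have hU := topCount_le_flat_sharp M 12 43 (by norm_num) (by norm_num) hR hn hfree 19 10 hflat hflat' (by norm_num) (by norm_num)
    946 26488 865192 hs3 hs4 hs5
  have hA := ncard_eRk_le_five_le_flats M 12 43 (by norm_num) hR hn hfree 19 10 hflat hflat' (by norm_num) (by norm_num)
    (by norm_num) (by norm_num) 946 26488 865192 hs3 hs4 hs5
  rw [RLS_iff]
  refine c025_core_five_cell_key M 12 43 hn _ hU _ hA (phiK 12 5) (by rw [S2LP.phiK_twelve_five]; norm_num) ?_
  rw [S2LP.phiK_twelve_five]
  norm_num [Finset.sum_range_succ, Finset.sum_Icc_succ_top, Nat.choose]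

set_option maxRecDepth 8192 in
/-- **The key cell `(12, 44)`**: `RLS M 12 5` on every `e`-free core of rank `12` on `56` points (caps `990 / 28842 / 963509`; `#U ≤ 7737143334448269949297 / 1246543197900`,
`#{r ≤ 5} ≤ 23260116481874133372781 / 3739629593700`, `Σ_{s=6}^{11} C(56, s) = 193770115071`; ratio `0.613`). -/
theorem c025_twelve_key_44 (M : Matroid α) [M.Finite]
    (hR : M.eRank = ((12 : ℕ) : ℕ∞)) (hn : M.E.ncard = 12 + 44)
    (hfree : ∀ e ∈ M.E, ∃ A ⊆ M.E \ {e}, e ∉ M.closure A ∧ e ∉ M.closure ((M.E \ {e}) \ A)) : RLS M 12 5 := by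
  classical
  have hd : M.E.encard = M.eRank + ((44 : ℕ) : ℕ∞) := by
    rw [hR, ← M.ground_finite.cast_ncard_eq, hn]
    push_cast
    ring
  have hs3 := TriangleCap.core_ncard_triangles_le_cq3 M hfree hd
  rw [show TriangleCap.cq3 44 = 990 by decide] at hs3
  have hs4 := ncard_fourCircuits_le_avgChain16 44 M hfree hd
  rw [show avgChain16 44 = 28842 by decide] at hs4
  have hs5 := S1.ncard_fiveCircuits_le_avgChain5b 44 M hfree hd
  rw [show S1.avgChain5b 44 = 963509 by decide] at hs5
  have hflat : ∀ X ⊆ M.E, M.eRk X ≤ 5 → X.ncard ≤ 19 := fun X hX hr => ncard_le_nineteen_of_eRk_le_five_of_free M hfree hX hr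
  have hflat' : ∀ X ⊆ M.E, M.eRk X ≤ 4 → X.ncard ≤ 10 := fun X hX hr => ncard_le_ten_of_eRk_le_four_of_free M hfree hX hr
  have hU := topCount_le_flat_sharp M 12 44 (by norm_num) (by norm_num) hR hn hfree 19 10 hflat hflat' (by norm_num) (by norm_num)
    990 28842 963509 hs3 hs4 hs5
  have hA := ncard_eRk_le_five_le_flats M 12 44 (by norm_num) hR hn hfree 19 10 hflat hflat' (by norm_num) (by norm_num)
    (by norm_num) (by norm_num) 990 28842 963509 hs3 hs4 hs5
  rw [RLS_iff]
  refine c025_core_five_cell_key M 12 44 hn _ hU _ hA (phiK 12 5) (by rw [S2LP.phiK_twelve_five]; norm_num) ?_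
  rw [S2LP.phiK_twelve_five]
  norm_num [Finset.sum_range_succ, Finset.sum_Icc_succ_top, Nat.choose]

set_option maxRecDepth 8192 in
/-- **The key cell `(12, 45)`**: `RLS M 12 5` on every `e`-free core of rank `12` on `57` points (caps `1035 / 31350 / 1070565`; `#U ≤ 10031505360198636886718 / 1433524677585`,
`#{r ≤ 5} ≤ 10051997056723773573568 / 1433524677585`, `Σ_{s=6}^{11} C(57, s) = 238641834678`; ratio `0.561`). -/
theorem c025_twelve_key_45 (M : Matroid α) [M.Finite]
    (hR : M.eRank = ((12 : ℕ) : ℕ∞)) (hn : M.E.ncard = 12 + 45)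
    (hfree : ∀ e ∈ M.E, ∃ A ⊆ M.E \ {e}, e ∉ M.closure A ∧ e ∉ M.closure ((M.E \ {e}) \ A)) : RLS M 12 5 := by
  classical
  have hd : M.E.encard = M.eRank + ((45 : ℕ) : ℕ∞) := by
    rw [hR, ← M.ground_finite.cast_ncard_eq, hn]
    push_cast
    ring
  have hs3 := TriangleCap.core_ncard_triangles_le_cq3 M hfree hd
  rw [show TriangleCap.cq3 45 = 1035 by decide] at hs3
  have hs4 := ncard_fourCircuits_le_avgChain16 45 M hfree hd
  rw [show avgChain16 45 = 31350 by decide] at hs4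
  have hs5 := S1.ncard_fiveCircuits_le_avgChain5b 45 M hfree hd
  rw [show S1.avgChain5b 45 = 1070565 by decide] at hs5
  have hflat : ∀ X ⊆ M.E, M.eRk X ≤ 5 → X.ncard ≤ 19 := fun X hX hr => ncard_le_nineteen_of_eRk_le_five_of_free M hfree hX hr
  have hflat' : ∀ X ⊆ M.E, M.eRk X ≤ 4 → X.ncard ≤ 10 := fun X hX hr => ncard_le_ten_of_eRk_le_four_of_free M hfree hX hr
  have hU := topCount_le_flat_sharp M 12 45 (by norm_num) (by norm_num) hR hn hfree 19 10 hflat hflat' (by norm_num) (by norm_num)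
    1035 31350 1070565 hs3 hs4 hs5
  have hA := ncard_eRk_le_five_le_flats M 12 45 (by norm_num) hR hn hfree 19 10 hflat hflat' (by norm_num) (by norm_num)
    (by norm_num) (by norm_num) 1035 31350 1070565 hs3 hs4 hs5
  rw [RLS_iff]
  refine c025_core_five_cell_key M 12 45 hn _ hU _ hA (phiK 12 5) (by rw [S2LP.phiK_twelve_five]; norm_num) ?_
  rw [S2LP.phiK_twelve_five]
  norm_num [Finset.sum_range_succ, Finset.sum_Icc_succ_top, Nat.choose]

set_option maxRecDepth 8192 in
/-- **The key cell `(12, 46)`**: `RLS M 12 5` on every `e`-free core of rank `12` on `58` points (caps `1081 / 34018 / 1186930`; `#U ≤ 75221171369687043880573 / 9556831183900`,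
`#{r ≤ 5} ≤ 678338157779543250133687 / 86011480655100`, `Σ_{s=6}^{11} C(58, s) = 292778589702`; ratio `0.515`). -/
theorem c025_twelve_key_46 (M : Matroid α) [M.Finite]
    (hR : M.eRank = ((12 : ℕ) : ℕ∞)) (hn : M.E.ncard = 12 + 46)
    (hfree : ∀ e ∈ M.E, ∃ A ⊆ M.E \ {e}, e ∉ M.closure A ∧ e ∉ M.closure ((M.E \ {e}) \ A)) : RLS M 12 5 := by
  classical
  have hd : M.E.encard = M.eRank + ((46 : ℕ) : ℕ∞) := by
    rw [hR, ← M.ground_finite.cast_ncard_eq, hn]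
    push_cast
    ring
  have hs3 := TriangleCap.core_ncard_triangles_le_cq3 M hfree hd
  rw [show TriangleCap.cq3 46 = 1081 by decide] at hs3
  have hs4 := ncard_fourCircuits_le_avgChain16 46 M hfree hd
  rw [show avgChain16 46 = 34018 by decide] at hs4
  have hs5 := S1.ncard_fiveCircuits_le_avgChain5b 46 M hfree hd
  rw [show S1.avgChain5b 46 = 1186930 by decide] at hs5
  have hflat : ∀ X ⊆ M.E, M.eRk X ≤ 5 → X.ncard ≤ 19 := fun X hX hr => ncard_le_nineteen_of_eRk_le_five_of_free M hfree hX hr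
  have hflat' : ∀ X ⊆ M.E, M.eRk X ≤ 4 → X.ncard ≤ 10 := fun X hX hr => ncard_le_ten_of_eRk_le_four_of_free M hfree hX hr
  have hU := topCount_le_flat_sharp M 12 46 (by norm_num) (by norm_num) hR hn hfree 19 10 hflat hflat' (by norm_num) (by norm_num)
    1081 34018 1186930 hs3 hs4 hs5
  have hA := ncard_eRk_le_five_le_flats M 12 46 (by norm_num) hR hn hfree 19 10 hflat hflat' (by norm_num) (by norm_num)
    (by norm_num) (by norm_num) 1081 34018 1186930 hs3 hs4 hs5
  rw [RLS_iff]
  refine c025_core_five_cell_key M 12 46 hn _ hU _ hA (phiK 12 5) (by rw [S2LP.phiK_twelve_five]; norm_num) ?_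
  rw [S2LP.phiK_twelve_five]
  norm_num [Finset.sum_range_succ, Finset.sum_Icc_succ_top, Nat.choose]

set_option maxRecDepth 8192 in
/-- **The key cell `(12, 47)`**: `RLS M 12 5` on every `e`-free core of rank `12` on `59` points (caps `1128 / 36852 / 1313199`; `#U ≤ 29220610897157921110229 / 3308133871350`,
`#{r ≤ 5} ≤ 14638662987916560616357 / 1654066935675`, `Σ_{s=6}^{11} C(59, s) = 357869474880`; ratio `0.473`). -/
theorem c025_twelve_key_47 (M : Matroid α) [M.Finite]
    (hR : M.eRank = ((12 : ℕ) : ℕ∞)) (hn : M.E.ncard = 12 + 47)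
    (hfree : ∀ e ∈ M.E, ∃ A ⊆ M.E \ {e}, e ∉ M.closure A ∧ e ∉ M.closure ((M.E \ {e}) \ A)) : RLS M 12 5 := by
  classical
  have hd : M.E.encard = M.eRank + ((47 : ℕ) : ℕ∞) := by
    rw [hR, ← M.ground_finite.cast_ncard_eq, hn]
    push_cast
    ring
  have hs3 := TriangleCap.core_ncard_triangles_le_cq3 M hfree hd
  rw [show TriangleCap.cq3 47 = 1128 by decide] at hs3
  have hs4 := ncard_fourCircuits_le_avgChain16 47 M hfree hd
  rw [show avgChain16 47 = 36852 by decide] at hs4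
  have hs5 := S1.ncard_fiveCircuits_le_avgChain5b 47 M hfree hd
  rw [show S1.avgChain5b 47 = 1313199 by decide] at hs5
  have hflat : ∀ X ⊆ M.E, M.eRk X ≤ 5 → X.ncard ≤ 19 := fun X hX hr => ncard_le_nineteen_of_eRk_le_five_of_free M hfree hX hr
  have hflat' : ∀ X ⊆ M.E, M.eRk X ≤ 4 → X.ncard ≤ 10 := fun X hX hr => ncard_le_ten_of_eRk_le_four_of_free M hfree hX hr
  have hU := topCount_le_flat_sharp M 12 47 (by norm_num) (by norm_num) hR hn hfree 19 10 hflat hflat' (by norm_num) (by norm_num)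
    1128 36852 1313199 hs3 hs4 hs5
  have hA := ncard_eRk_le_five_le_flats M 12 47 (by norm_num) hR hn hfree 19 10 hflat hflat' (by norm_num) (by norm_num)
    (by norm_num) (by norm_num) 1128 36852 1313199 hs3 hs4 hs5
  rw [RLS_iff]
  refine c025_core_five_cell_key M 12 47 hn _ hU _ hA (phiK 12 5) (by rw [S2LP.phiK_twelve_five]; norm_num) ?_
  rw [S2LP.phiK_twelve_five]
  norm_num [Finset.sum_range_succ, Finset.sum_Icc_succ_top, Nat.choose]

set_option maxRecDepth 8192 in
/-- **The key cell `(12, 48)`**: `RLS M 12 5` on every `e`-free core of rank `12` on `60` points (caps `1176 / 39860 / 1449990`; `#U ≤ 28358149347019543572617 / 2867049355170`,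
`#{r ≤ 5} ≤ 17047108344331492930961 / 1720229613102`, `Σ_{s=6}^{11} C(60, s) = 435872187151`; ratio `0.434`). -/
theorem c025_twelve_key_48 (M : Matroid α) [M.Finite]
    (hR : M.eRank = ((12 : ℕ) : ℕ∞)) (hn : M.E.ncard = 12 + 48)
    (hfree : ∀ e ∈ M.E, ∃ A ⊆ M.E \ {e}, e ∉ M.closure A ∧ e ∉ M.closure ((M.E \ {e}) \ A)) : RLS M 12 5 := by
  classical
  have hd : M.E.encard = M.eRank + ((48 : ℕ) : ℕ∞) := by
    rw [hR, ← M.ground_finite.cast_ncard_eq, hn]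
    push_cast
    ring
  have hs3 := TriangleCap.core_ncard_triangles_le_cq3 M hfree hd
  rw [show TriangleCap.cq3 48 = 1176 by decide] at hs3
  have hs4 := ncard_fourCircuits_le_avgChain16 48 M hfree hd
  rw [show avgChain16 48 = 39860 by decide] at hs4
  have hs5 := S1.ncard_fiveCircuits_le_avgChain5b 48 M hfree hd
  rw [show S1.avgChain5b 48 = 1449990 by decide] at hs5
  have hflat : ∀ X ⊆ M.E, M.eRk X ≤ 5 → X.ncard ≤ 19 := fun X hX hr => ncard_le_nineteen_of_eRk_le_five_of_free M hfree hX hr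
  have hflat' : ∀ X ⊆ M.E, M.eRk X ≤ 4 → X.ncard ≤ 10 := fun X hX hr => ncard_le_ten_of_eRk_le_four_of_free M hfree hX hr
  have hU := topCount_le_flat_sharp M 12 48 (by norm_num) (by norm_num) hR hn hfree 19 10 hflat hflat' (by norm_num) (by norm_num)
    1176 39860 1449990 hs3 hs4 hs5
  have hA := ncard_eRk_le_five_le_flats M 12 48 (by norm_num) hR hn hfree 19 10 hflat hflat' (by norm_num) (by norm_num)
    (by norm_num) (by norm_num) 1176 39860 1449990 hs3 hs4 hs5
  rw [RLS_iff]
  refine c025_core_five_cell_key M 12 48 hn _ hU _ hA (phiK 12 5) (by rw [S2LP.phiK_twelve_five]; norm_num) ?_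
  rw [S2LP.phiK_twelve_five]
  norm_num [Finset.sum_range_succ, Finset.sum_Icc_succ_top, Nat.choose]

set_option maxRecDepth 8192 in
/-- **The key cell `(12, 49)`**: `RLS M 12 5` on every `e`-free core of rank `12` on `61` points (caps `1225 / 43048 / 1597948`; `#U ≤ 45269394584538120760759 / 4095784793100`,
`#{r ≤ 5} ≤ 136059204123927596133607 / 12287354379300`, `Σ_{s=6}^{11} C(61, s) = 529049710514`; ratio `0.400`). -/
theorem c025_twelve_key_49 (M : Matroid α) [M.Finite]
    (hR : M.eRank = ((12 : ℕ) : ℕ∞)) (hn : M.E.ncard = 12 + 49)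
    (hfree : ∀ e ∈ M.E, ∃ A ⊆ M.E \ {e}, e ∉ M.closure A ∧ e ∉ M.closure ((M.E \ {e}) \ A)) : RLS M 12 5 := by
  classical
  have hd : M.E.encard = M.eRank + ((49 : ℕ) : ℕ∞) := by
    rw [hR, ← M.ground_finite.cast_ncard_eq, hn]
    push_cast
    ring
  have hs3 := TriangleCap.core_ncard_triangles_le_cq3 M hfree hd
  rw [show TriangleCap.cq3 49 = 1225 by decide] at hs3
  have hs4 := ncard_fourCircuits_le_avgChain16 49 M hfree hd
  rw [show avgChain16 49 = 43048 by decide] at hs4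
  have hs5 := S1.ncard_fiveCircuits_le_avgChain5b 49 M hfree hd
  rw [show S1.avgChain5b 49 = 1597948 by decide] at hs5
  have hflat : ∀ X ⊆ M.E, M.eRk X ≤ 5 → X.ncard ≤ 19 := fun X hX hr => ncard_le_nineteen_of_eRk_le_five_of_free M hfree hX hr
  have hflat' : ∀ X ⊆ M.E, M.eRk X ≤ 4 → X.ncard ≤ 10 := fun X hX hr => ncard_le_ten_of_eRk_le_four_of_free M hfree hX hr
  have hU := topCount_le_flat_sharp M 12 49 (by norm_num) (by norm_num) hR hn hfree 19 10 hflat hflat' (by norm_num) (by norm_num)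
    1225 43048 1597948 hs3 hs4 hs5
  have hA := ncard_eRk_le_five_le_flats M 12 49 (by norm_num) hR hn hfree 19 10 hflat hflat' (by norm_num) (by norm_num)
    (by norm_num) (by norm_num) 1225 43048 1597948 hs3 hs4 hs5
  rw [RLS_iff]
  refine c025_core_five_cell_key M 12 49 hn _ hU _ hA (phiK 12 5) (by rw [S2LP.phiK_twelve_five]; norm_num) ?_
  rw [S2LP.phiK_twelve_five]
  norm_num [Finset.sum_range_succ, Finset.sum_Icc_succ_top, Nat.choose]

set_option maxRecDepth 8192 in
/-- **The key cell `(12, 50)`**: `RLS M 12 5` on every `e`-free core of rank `12` on `62` points (caps `1275 / 46424 / 1757742`; `#U ≤ 29449011111052061662544 / 2389207795975`,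
`#{r ≤ 5} ≤ 531039073368322330518097 / 43005740327550`, `Σ_{s=6}^{11} C(62, s) = 640011217309`; ratio `0.369`). -/
theorem c025_twelve_key_50 (M : Matroid α) [M.Finite]
    (hR : M.eRank = ((12 : ℕ) : ℕ∞)) (hn : M.E.ncard = 12 + 50)
    (hfree : ∀ e ∈ M.E, ∃ A ⊆ M.E \ {e}, e ∉ M.closure A ∧ e ∉ M.closure ((M.E \ {e}) \ A)) : RLS M 12 5 := by
  classical
  have hd : M.E.encard = M.eRank + ((50 : ℕ) : ℕ∞) := by
    rw [hR, ← M.ground_finite.cast_ncard_eq, hn]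
    push_cast
    ring
  have hs3 := TriangleCap.core_ncard_triangles_le_cq3 M hfree hd
  rw [show TriangleCap.cq3 50 = 1275 by decide] at hs3
  have hs4 := ncard_fourCircuits_le_avgChain16 50 M hfree hd
  rw [show avgChain16 50 = 46424 by decide] at hs4
  have hs5 := S1.ncard_fiveCircuits_le_avgChain5b 50 M hfree hd
  rw [show S1.avgChain5b 50 = 1757742 by decide] at hs5
  have hflat : ∀ X ⊆ M.E, M.eRk X ≤ 5 → X.ncard ≤ 19 := fun X hX hr => ncard_le_nineteen_of_eRk_le_five_of_free M hfree hX hr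
  have hflat' : ∀ X ⊆ M.E, M.eRk X ≤ 4 → X.ncard ≤ 10 := fun X hX hr => ncard_le_ten_of_eRk_le_four_of_free M hfree hX hr
  have hU := topCount_le_flat_sharp M 12 50 (by norm_num) (by norm_num) hR hn hfree 19 10 hflat hflat' (by norm_num) (by norm_num)
    1275 46424 1757742 hs3 hs4 hs5
  have hA := ncard_eRk_le_five_le_flats M 12 50 (by norm_num) hR hn hfree 19 10 hflat hflat' (by norm_num) (by norm_num)
    (by norm_num) (by norm_num) 1275 46424 1757742 hs3 hs4 hs5
  rw [RLS_iff]
  refine c025_core_five_cell_key M 12 50 hn _ hU _ hA (phiK 12 5) (by rw [S2LP.phiK_twelve_five]; norm_num) ?_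
  rw [S2LP.phiK_twelve_five]
  norm_num [Finset.sum_range_succ, Finset.sum_Icc_succ_top, Nat.choose]


end ThmN

end PercRepro
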